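import Summits.ResolutionOfSingularities.ResolutionOfSingularities.Theorems.FrobeniusLadderFRationalResolutionFixedPointFibre
import Mathlib.GroupTheory.QuotientGroup.Basic
import Mathlib.GroupTheory.OrderOfElement
import HarnessLib

/-!
# Crux `FrobeniusLadder.FRationalResolution` (stmt-ResolutionOfSingularities-15317), line `redirect`,
# stub `stub_diagonalizableQuotientResolution` — COARSENING a grading along a homomorphism of the
# grading group (restriction of the `D(A)`-action to a subgroup scheme `D(A/B)`), and: every prime is
# a FIXED point for the grading coarsened by its unit-degree subgroup `B_𝔔`

The fixed-point milestone `…FixedPointLogRegular.exists_isLogRegularAt_of_fixed` applies to primes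
`𝔔` containing every piece of non-zero degree. An arbitrary prime `𝔔` becomes such a fixed point
after coarsening the grading along `A → A/B_𝔔`, `B_𝔔` the subgroup of degrees carrying a unit at
`𝔔` (`…StabilizerSubgroup`). This file constructs the coarsened grading (as an existential package,
no new definitions) and records that fact:

* `decompose_apply_eq_zero_of_mem_biSup` — an element of `⨆_{a ∈ T} S_a` has zero components
  outside `T`;
* `exists_coarsening` — for `f : A →+ A'`, the pieces `S'_c = ⨆_{f a = c} S_a` make `S` a graded
  algebra over `A'` (graded monoid; independence and spanning from the `A`-decomposition);
* `exists_coarsening_fixed` — for a prime `𝔔` (torsion grading) and `B = B_𝔔`: `S` is graded by the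
  torsion group `A/B` with `S_a ⊆ S'_{[a]}`, `S₀ ⊆ S'_0 = ⊕_{b ∈ B} S_b`, and `𝔔 ⊇ S'_c` for every
  `c ≠ 0` — `𝔔` is a fixed prime for the coarsened grading.

Honest label: brick R1 of the non-fixed-point reduction (no stub closed; the `D(B)`-torsor descent
`S₀ ← S'_0` is not here). No definitions, no named facts, no sorry. [folklore; cite: SGA3, Exp. VIII §4–5]
-/

noncomputable section

-- single-problem summit: the doubled namespace component is forced
set_option linter.dupNamespace false

open DirectSum

namespace Summit.ResolutionOfSingularities.ResolutionOfSingularities.Theorems.FRationalResolution.Coarsening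

universe u v w w'

variable {R : Type u} {S : Type v} {A : Type w} [CommRing R] [CommRing S] [Algebra R S]
  [DecidableEq A] [AddCommGroup A] (𝒮 : A → Submodule R S) [GradedAlgebra 𝒮]

/-- An element of `⨆_{a ∈ T} S_a` has zero homogeneous components outside `T`. [folklore] -/
theorem decompose_apply_eq_zero_of_mem_biSup {T : Set A} {x : S} (hx : x ∈ ⨆ a ∈ T, 𝒮 a)
    {i : A} (hi : i ∉ T) : (decompose 𝒮 x i : S) = 0 := by
  induction hx using Submodule.iSup_induction' with
  | mem j y hy =>
    by_cases hjT : j ∈ T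
    · rw [iSup_pos hjT] at hy
      exact decompose_of_mem_ne 𝒮 hy (fun h => hi (h ▸ hjT))
    · rw [iSup_neg hjT, Submodule.mem_bot] at hy
      simp [hy]
  | zero => simp
  | add y z _ _ hy hz => simp [decompose_add, hy, hz]

/-- **Coarsening a grading along a homomorphism of the grading group.** For `f : A →+ A'` the pieces
`S'_c = ⨆_{f a = c} S_a` form a graded algebra structure on `S` over `A'`, with `S_a ⊆ S'_{f a}`
(existential package: the pieces, a `GradedAlgebra` structure, and their description).
[folklore; cite: SGA3, Exp. VIII §4–5] -/
theorem exists_coarsening {A' : Type w'} [DecidableEq A'] [AddCommGroup A'] (f : A →+ A') :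
    ∃ (𝒮' : A' → Submodule R S) (_ : GradedAlgebra 𝒮'),
      (∀ c, 𝒮' c = ⨆ a ∈ {a : A | f a = c}, 𝒮 a) ∧ (∀ a, 𝒮 a ≤ 𝒮' (f a)) := by
  classical
  let 𝒮' : A' → Submodule R S := fun c => ⨆ a ∈ {a : A | f a = c}, 𝒮 a
  have hle : ∀ a, 𝒮 a ≤ 𝒮' (f a) := fun a =>
    le_biSup (fun a => 𝒮 a) (show a ∈ {a' : A | f a' = f a} from rfl)
  -- graded monoid
  haveI hmon : SetLike.GradedMonoid 𝒮' :=
    { one_mem := by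
        have h := hle 0 (SetLike.one_mem_graded 𝒮)
        rwa [map_zero] at h
      mul_mem := by
        intro c c' x y hx hy
        induction hx using Submodule.iSup_induction' with
        | mem a x hx =>
          by_cases ha : a ∈ {a : A | f a = c}
          · rw [iSup_pos ha] at hx
            induction hy using Submodule.iSup_induction' with
            | mem a' y hy =>
              by_cases ha' : a' ∈ {a : A | f a = c'}
              · rw [iSup_pos ha'] at hy
                have hxy : x * y ∈ 𝒮 (a + a') := SetLike.mul_mem_graded hx hy
                have hdeg : f (a + a') = c + c' := by
                  rw [map_add, show f a = c from ha, show f a' = c' from ha']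
                exact (hdeg ▸ hle (a + a')) hxy
              · rw [iSup_neg ha', Submodule.mem_bot] at hy
                simp [hy]
            | zero => simp
            | add y z _ _ hy hz => rw [mul_add]; exact Submodule.add_mem _ hy hz
          · rw [iSup_neg ha, Submodule.mem_bot] at hx
            simp [hx]
        | zero => simp
        | add x z _ _ hx hz => rw [add_mul]; exact Submodule.add_mem _ hx hz }
  -- spanning
  have htop : ⨆ c, 𝒮' c = ⊤ := by
    rw [eq_top_iff]
    rintro x -
    rw [← sum_support_decompose 𝒮 x]
    refine Submodule.sum_mem _ fun a _ => ?_
    exact Submodule.mem_iSup_of_mem (f a) (hle a (decompose 𝒮 x a).2)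
  -- independence
  have hind : iSupIndep 𝒮' := by
    rw [iSupIndep_def]
    intro c
    rw [Submodule.disjoint_def]
    intro x hx hx'
    have hle' : (⨆ c' ≠ c, 𝒮' c') ≤ ⨆ a ∈ {a : A | f a ≠ c}, 𝒮 a := by
      refine iSup₂_le fun c' hc' => ?_
      refine iSup₂_le fun a ha => ?_
      have ha' : f a = c' := ha
      exact le_biSup (fun a => 𝒮 a) (show a ∈ {a : A | f a ≠ c} by
        rw [Set.mem_setOf_eq, ha']; exact hc')
    have hx'' : x ∈ ⨆ a ∈ {a : A | f a ≠ c}, 𝒮 a := hle' hx'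
    rw [← sum_support_decompose 𝒮 x]
    refine Finset.sum_eq_zero fun a _ => ?_
    by_cases ha : f a = c
    · exact decompose_apply_eq_zero_of_mem_biSup 𝒮 hx'' (show a ∉ {a : A | f a ≠ c} from
        fun h => h ha)
    · exact decompose_apply_eq_zero_of_mem_biSup 𝒮 hx ha
  have hint : DirectSum.IsInternal 𝒮' :=
    (DirectSum.isInternal_submodule_iff_iSupIndep_and_iSup_eq_top _).2 ⟨hind, htop⟩
  exact ⟨𝒮', hint.gradedAlgebra, fun c => rfl, hle⟩

/-- **Every prime is a fixed point for the grading coarsened by its unit-degree subgroup.** For a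
torsion grading, a prime `𝔔` and its subgroup `B = B_𝔔` of degrees carrying a unit at `𝔔`
(`StabilizerSubgroup.exists_unitDegrees_addSubgroup`): `S` is graded by the torsion group `A/B`
with pieces `S'_c = ⨆_{[a] = c} S_a ⊇ S_a`, and `S'_c ⊆ 𝔔` for every `c ≠ 0` — the hypothesis
`hfix` of the fixed-point files for the coarsened grading (whose degree-`0` part
`S'_0 = ⊕_{b ∈ B} S_b` contains `S₀`). [folklore; cite: SGA3, Exp. VIII §4–5] -/
theorem exists_coarsening_fixed (hA : AddMonoid.IsTorsion A) (𝔔 : Ideal S) [𝔔.IsPrime]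
    (B : AddSubgroup A) (hB : ∀ a : A, a ∈ B ↔ ∃ s ∈ 𝒮 a, s ∉ 𝔔) [DecidableEq (A ⧸ B)] :
    ∃ (𝒮' : A ⧸ B → Submodule R S) (_ : GradedAlgebra 𝒮'),
      (∀ c, 𝒮' c = ⨆ a ∈ {a : A | (a : A ⧸ B) = c}, 𝒮 a) ∧ (∀ a, 𝒮 a ≤ 𝒮' (a : A ⧸ B)) ∧
      (∀ c : A ⧸ B, c ≠ 0 → ∀ s ∈ 𝒮' c, s ∈ 𝔔) ∧ AddMonoid.IsTorsion (A ⧸ B) := by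
  obtain ⟨𝒮', inst, h𝒮', hle⟩ := exists_coarsening 𝒮 (QuotientAddGroup.mk' B)
  refine ⟨𝒮', inst, h𝒮', hle, fun c hc s hs => ?_, fun c => ?_⟩
  · rw [h𝒮' c] at hs
    induction hs using Submodule.iSup_induction' with
    | mem a x hx =>
      by_cases ha : a ∈ {a : A | (QuotientAddGroup.mk' B) a = c}
      · rw [iSup_pos ha] at hx
        -- `a ∉ B` since its class is `c ≠ 0`
        have haB : a ∉ B := by
          intro haB
          apply hc
          rw [← show (QuotientAddGroup.mk' B) a = c from ha, QuotientAddGroup.mk'_apply,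
            QuotientAddGroup.eq_zero_iff]
          exact haB
        by_contra hxQ
        exact haB ((hB a).mpr ⟨x, hx, hxQ⟩)
      · rw [iSup_neg ha, Submodule.mem_bot] at hx
        rw [hx]
        exact 𝔔.zero_mem
    | zero => exact 𝔔.zero_mem
    | add x y _ _ hx hy => exact 𝔔.add_mem hx hy
  · obtain ⟨a, rfl⟩ := QuotientAddGroup.mk_surjective c
    exact (QuotientAddGroup.mk' B).isOfFinAddOrder (hA a)

end Summit.ResolutionOfSingularities.ResolutionOfSingularities.Theorems.FRationalResolution.Coarsening

end
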